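import Literature.Barriers.ValiantsHypothesis.FullRankMultilinearProductRank
import Literature.Barriers.ValiantsHypothesis.FullRankMultilinearThm20
import HarnessLib

/-!
# Ranks of log-product terms and the first steps of the counting assembly
(Raz 2006, Lemma 3.3 / Cor. 3.6 mechanism; roadmap step (a4-i) towards the multilinear-formula slice)

Support file for the partial-derivative-matrix method (`FullRankMultilinear*.lean`), in the `cm`
formalism of `FullRankMultilinearRank.lean`.  A LOG-PRODUCT TERM is `g₀ · ∏_j A_j` with
`g₀ ∈ K[X₀]`, `A_j ∈ K[V_j]` and `X₀, V₁, …, V_m` pairwise disjoint (the output format of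
`RazFormula.decompIter`).  Here:

* `rank_cm_mul_listProd_le` — `rank M_{Y,Z}(g₀ ∏_j A_j) ≤ 2^{min(|Y∩X₀|,|Z∩X₀|)} ·
  ∏_j 2^{min(|Y∩V_j|,|Z∩V_j|)}` (list form of `AKV.rank_cm_prod_le`; [Raz2006, Prop. 3.2 and
  the proof of Lemma 3.3]);
* `rank_cm_listSum_le` — `rank M(Σ_i f_i) ≤ Σ_i rank M(f_i)` for lists [Raz2006, Prop. 3.1];
* `exists_term_rank_ge` — if a full-rank `g` is a sum of `≤ N` terms, then for every balanced `Y`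
  some term has `N · rank M_{Y,Yᶜ}(term) ≥ 2^u` — the union-bound step of [Raz2006, Cor. 3.6];
* `two_mul_min_add_dist` / `sum_dist_le_of_rank_exponent` — the integer bookkeeping
  `2 min(y, x−y) + |2y−x| = x`: if `Σ_i min(y_i, x_i−y_i) ≥ u − D` with `Σ_i x_i ≤ 2u` then every
  set is `D`-balanced (`|2y_i − x_i| ≤ 2D`) and at most `2D` of the `2u` variables are uncovered
  (the link between the rank exponent and the windows of `RazCut.card_balanced_windows_le`);
* `not_isFullRank_of_supported` — a polynomial missing a variable is not of full rank
  (so formulas not using all `2u` variables are harmless) [Raz2006, proof of Cor. 3.6: "we can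
  assume w.l.o.g. that all the variables in X occur in Φ"].

## References
* [Raz2006] R. Raz, *Separation of multilinear circuit and formula size*, Theory of Computing 2
  (2006) 121–135, Prop. 3.1, Prop. 3.2, Lemma 3.3, Cor. 3.6.
-/

noncomputable section

namespace Literature.Barriers.ValiantsHypothesis.AKV

open MvPolynomial Finset RazYehudayoff

variable {K : Type*} [Field K] {σ : Type*} [Fintype σ] [DecidableEq σ]

/-! ### Rank of a log-product term (list form) -/

/-- **Rank of a log-product term.**  For `g₀ ∈ K[X₀]` and cofactors `A_j ∈ K[V_j]` with
`X₀, V₁, …, V_m` pairwise disjoint: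
`rank M_{Y,Z}(g₀ · ∏_j A_j) ≤ 2^{min(|Y ∩ X₀|, |Z ∩ X₀|)} · ∏_j 2^{min(|Y ∩ V_j|, |Z ∩ V_j|)}`.
[cite: Raz2006, Prop. 3.2 and Lemma 3.3] -/
theorem rank_cm_mul_listProd_le (Y Z X₀ : Finset σ) {g₀ : MvPolynomial σ K}
    (hg₀ : g₀ ∈ supported K (↑X₀ : Set σ)) :
    ∀ (L : List (MvPolynomial σ K × Finset σ)),
      (∀ q ∈ L, q.1 ∈ supported K (↑q.2 : Set σ)) → (∀ q ∈ L, Disjoint q.2 X₀) →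
      (L.map Prod.snd).Pairwise Disjoint →
        (cm (g₀ * (L.map Prod.fst).prod) Y Z).rank ≤
          2 ^ min (Y ∩ X₀).card (Z ∩ X₀).card *
            (L.map fun q => 2 ^ min (Y ∩ q.2).card (Z ∩ q.2).card).prod := by
  intro L
  induction L with
  | nil =>
    intro _ _ _
    simp only [List.map_nil, List.prod_nil, mul_one]
    rcases le_total (Y ∩ X₀).card (Z ∩ X₀).card with h | h
    · rw [min_eq_left h]; exact rank_cm_le_pow_of_supported hg₀ Y Z
    · rw [min_eq_right h, rank_cm_swap]; exact rank_cm_le_pow_of_supported hg₀ Z Y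
  | cons q L ih =>
    intro hA hdis hpw
    rw [List.map_cons, List.pairwise_cons] at hpw
    have hA' : ∀ q' ∈ L, q'.1 ∈ supported K (↑q'.2 : Set σ) := fun q' hq' => hA q' (List.mem_cons_of_mem _ hq')
    have hdis' : ∀ q' ∈ L, Disjoint q'.2 X₀ := fun q' hq' => hdis q' (List.mem_cons_of_mem _ hq')
    have hrest := ih hA' hdis' hpw.2
    -- the rest `g₀ · ∏_{L} A` lives in the variables `(q.2)ᶜ`
    have hsupp : g₀ * (L.map Prod.fst).prod ∈ supported K (↑((q.2)ᶜ) : Set σ) := by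
      refine Subalgebra.mul_mem _ (supported_mono ?_ hg₀) (Subalgebra.list_prod_mem _ fun A hAL => ?_)
      · intro x hx
        rw [Finset.coe_compl, Set.mem_compl_iff, Finset.mem_coe]
        exact fun hxq => Finset.disjoint_left.1 (hdis q List.mem_cons_self) hxq (Finset.mem_coe.1 hx)
      · obtain ⟨q', hq', rfl⟩ := List.mem_map.1 hAL
        refine supported_mono ?_ (hA' q' hq')
        intro x hx
        rw [Finset.coe_compl, Set.mem_compl_iff, Finset.mem_coe]
        have hd : Disjoint q.2 q'.2 := hpw.1 q'.2 (List.mem_map.2 ⟨q', hq', rfl⟩)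
        exact fun hxq => Finset.disjoint_left.1 hd hxq (Finset.mem_coe.1 hx)
    rw [List.map_cons, List.prod_cons, List.map_cons, List.prod_cons,
      show g₀ * (q.1 * (L.map Prod.fst).prod) = g₀ * (L.map Prod.fst).prod * q.1 by ring]
    calc (cm (g₀ * (L.map Prod.fst).prod * q.1) Y Z).rank
        ≤ (cm (g₀ * (L.map Prod.fst).prod) Y Z).rank * 2 ^ min (Y ∩ q.2).card (Z ∩ q.2).card :=
          rank_cm_mul_le_rank_mul_pow_min q.2 hsupp (hA q List.mem_cons_self) Y Z
      _ ≤ (2 ^ min (Y ∩ X₀).card (Z ∩ X₀).card *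
            (L.map fun q => 2 ^ min (Y ∩ q.2).card (Z ∩ q.2).card).prod) *
              2 ^ min (Y ∩ q.2).card (Z ∩ q.2).card := Nat.mul_le_mul_right _ hrest
      _ = _ := by ring

/-! ### Subadditivity over a list of terms, and the union-bound step -/

omit [Fintype σ] in
/-- `M_{Y,Z}` is additive over lists. [cite: Raz2006, Prop. 3.1] -/
theorem cm_listSum {ι : Type*} (L : List ι) (f : ι → MvPolynomial σ K) (Y Z : Finset σ) :
    cm ((L.map f).sum) Y Z = (L.map fun i => cm (f i) Y Z).sum := by
  induction L with
  | nil => ext P Q; simp [cm_apply]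
  | cons a L ih => rw [List.map_cons, List.sum_cons, cm_add, ih, List.map_cons, List.sum_cons]

/-- **`rank M(Σ_i f_i) ≤ Σ_i rank M(f_i)`** for a list of polynomials. [cite: Raz2006, Prop. 3.1] -/
theorem rank_cm_listSum_le {ι : Type*} (L : List ι) (f : ι → MvPolynomial σ K) (Y Z : Finset σ) :
    (cm ((L.map f).sum) Y Z).rank ≤ (L.map fun i => (cm (f i) Y Z).rank).sum := by
  induction L with
  | nil => rw [cm_listSum]; simp
  | cons a L ih =>
    rw [List.map_cons, List.sum_cons, List.map_cons, List.sum_cons]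
    exact (rank_cm_add_le _ _ Y Z).trans (Nat.add_le_add_left ih _)

/-- **The union-bound step.**  If `g = Σ_{i ∈ L} f_i` is of full rank (`2u` variables) and `Y` is
balanced, then some term has `|L| · rank M_{Y,Yᶜ}(f_i) ≥ 2^u`. [cite: Raz2006, Cor. 3.6 (proof)] -/
theorem exists_term_rank_ge {u : ℕ} {ι : Type*} (L : List ι) (f : ι → MvPolynomial (Fin (2 * u)) K)
    {g : MvPolynomial (Fin (2 * u)) K} (hg : IsFullRank u g) (hsum : (L.map f).sum = g)
    (Y : Finset (Fin (2 * u))) (hY : Y.card = u) :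
    ∃ i ∈ L, 2 ^ u ≤ L.length * (cm (f i) Y Yᶜ).rank := by
  classical
  obtain ⟨A, hYA, hZA⟩ := exists_equiv_of_balanced Y hY
  have hfull : (cm g Y Yᶜ).rank = 2 ^ u := by
    rw [← hZA, ← hYA, ← rank_pdMatrix_rename]; exact hg A
  have hle : 2 ^ u ≤ (L.map fun i => (cm (f i) Y Yᶜ).rank).sum := by
    rw [← hfull, ← hsum]; exact rank_cm_listSum_le L f Y Yᶜ
  -- a list of naturals with sum `≥ 2^u` has a member `≥ 2^u / |L|`
  by_contra hno
  push Not at hno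
  rcases Nat.eq_zero_or_pos L.length with h0 | hpos
  · have : L = [] := List.eq_nil_of_length_eq_zero h0
    subst this
    simp only [List.map_nil, List.sum_nil, nonpos_iff_eq_zero] at hle
    exact absurd hle (by positivity)
  · have h1 : (L.map fun i => L.length * (cm (f i) Y Yᶜ).rank).sum ≤
        (L.map fun i => L.length * (cm (f i) Y Yᶜ).rank).length • (2 ^ u - 1) :=
      List.sum_le_card_nsmul _ _ fun x hx => by
        obtain ⟨i, hi, rfl⟩ := List.mem_map.1 hx
        have := hno i hi
        omega
    rw [List.length_map, smul_eq_mul, List.sum_map_mul_left] at h1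
    have h2 : L.length * (2 ^ u - 1) + L.length = L.length * 2 ^ u := by
      have h1le : 1 ≤ 2 ^ u := Nat.one_le_two_pow
      rw [← Nat.mul_succ, Nat.succ_eq_add_one, Nat.sub_add_cancel h1le]
    have h3 : L.length * 2 ^ u ≤ L.length * (L.map fun i => (cm (f i) Y Yᶜ).rank).sum :=
      Nat.mul_le_mul_left _ hle
    omega

/-! ### From the rank exponent to balanced windows -/

/-- `2 · min(y, x − y) + |2y − x| = x` for `y ≤ x` (integer bookkeeping behind "unbalanced nodes
lose rank"). [cite: Raz2006, §3.2] -/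
theorem two_mul_min_add_natAbs {x y : ℕ} (hy : y ≤ x) :
    2 * min y (x - y) + Int.natAbs (2 * (y : ℤ) - x) = x := by
  rcases le_total y (x - y) with h | h
  · rw [min_eq_left h]
    have : Int.natAbs (2 * (y : ℤ) - x) = x - 2 * y := by omega
    omega
  · rw [min_eq_right h]
    have : Int.natAbs (2 * (y : ℤ) - x) = 2 * y - x := by omega
    omega

/-- **Rank exponent versus balance.**  For sets of sizes `x_i` with `Σ_i x_i ≤ 2u` ("covered
variables") and intersections `y_i ≤ x_i` with the `Y`-side: if the rank exponent
`Σ_i min(y_i, x_i − y_i)` is at least `u − D`, then EVERY set is `D`-balanced, `|2 y_i − x_i| ≤ 2D`,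
and at most `2D` variables are uncovered, `2u ≤ Σ_i x_i + 2D`. [cite: Raz2006, Lemma 3.3 (proof)] -/
theorem balanced_of_rank_exponent_ge {ι : Type*} (L : List ι) (x y : ι → ℕ) (hyx : ∀ i ∈ L, y i ≤ x i)
    {u D : ℕ} (hcov : (L.map x).sum ≤ 2 * u)
    (hexp : u ≤ (L.map fun i => min (y i) (x i - y i)).sum + D) :
    (∀ i ∈ L, Int.natAbs (2 * (y i : ℤ) - x i) ≤ 2 * D) ∧ 2 * u ≤ (L.map x).sum + 2 * D := by
  -- sum the identity `2 min + |2y − x| = x` over the list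
  have key : ∀ M : List ι, (∀ i ∈ M, y i ≤ x i) →
      2 * (M.map fun i => min (y i) (x i - y i)).sum +
        (M.map fun i => Int.natAbs (2 * (y i : ℤ) - x i)).sum = (M.map x).sum := by
    intro M hM
    induction M with
    | nil => simp
    | cons a M ih =>
      simp only [List.map_cons, List.sum_cons]
      have h1 := two_mul_min_add_natAbs (hM a List.mem_cons_self)
      have h2 := ih (fun i hi => hM i (List.mem_cons_of_mem _ hi))
      omega
  have hk := key L hyx
  refine ⟨fun i hi => ?_, by omega⟩
  have hmem : Int.natAbs (2 * (y i : ℤ) - x i) ≤ (L.map fun i => Int.natAbs (2 * (y i : ℤ) - x i)).sum :=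
    List.single_le_sum (fun _ _ => Nat.zero_le _) _ (List.mem_map.2 ⟨i, hi, rfl⟩)
  omega

/-! ### Formulas that miss a variable -/

/-- **A polynomial missing one of the `2u` variables is not of full rank** (choose a balanced
`Y` containing a missing variable: the rows through it vanish, `rank ≤ 2^{u−1}`).  Hence "we can
assume w.l.o.g. that all the variables occur in Φ". [cite: Raz2006, Cor. 3.6 (proof)] -/
theorem not_isFullRank_of_supported {u : ℕ} (hu : 1 ≤ u) {g : MvPolynomial (Fin (2 * u)) K}
    {W : Finset (Fin (2 * u))} (hW : W.card < 2 * u)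
    (hsupp : g ∈ supported K (↑W : Set (Fin (2 * u)))) : ¬ IsFullRank u g := by
  classical
  intro hg
  -- a variable outside `W`, and a balanced `Y` through it
  obtain ⟨x, hx⟩ : ∃ x : Fin (2 * u), x ∉ W := by
    by_contra h
    push Not at h
    have : (Finset.univ : Finset (Fin (2 * u))) ⊆ W := fun x _ => h x
    have := Finset.card_le_card this
    rw [Finset.card_univ, Fintype.card_fin] at this
    omega
  obtain ⟨Y₀, hY₀sub, hY₀card⟩ := Finset.exists_subset_card_eq
    (show u - 1 ≤ ((Finset.univ : Finset (Fin (2 * u))).erase x).card by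
      rw [Finset.card_erase_of_mem (Finset.mem_univ x), Finset.card_univ, Fintype.card_fin]; omega)
  set Y := insert x Y₀ with hYdef
  have hxY₀ : x ∉ Y₀ := fun h => by simpa using hY₀sub h
  have hY : Y.card = u := by rw [hYdef, Finset.card_insert_of_notMem hxY₀, hY₀card]; omega
  obtain ⟨A, hYA, hZA⟩ := exists_equiv_of_balanced Y hY
  have hfull : (cm g Y Yᶜ).rank = 2 ^ u := by
    rw [← hZA, ← hYA, ← rank_pdMatrix_rename]; exact hg A
  have h2 := rank_cm_le_pow_of_supported hsupp Y Yᶜ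
  have h3 : (Y ∩ W).card ≤ u - 1 := by
    have hsub : Y ∩ W ⊆ Y₀ := by
      intro z hz
      rw [Finset.mem_inter, hYdef, Finset.mem_insert] at hz
      rcases hz.1 with rfl | h
      · exact absurd hz.2 hx
      · exact h
    exact (Finset.card_le_card hsub).trans hY₀card.le
  have h4 : 2 ^ (Y ∩ W).card < 2 ^ u := Nat.pow_lt_pow_right (by norm_num) (by omega)
  omega

end Literature.Barriers.ValiantsHypothesis.AKV
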